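import Summits.HubbardSuperconductivity.HubbardSuperconductivity.Theorems.AnisotropyChordSpinMonotoneTwoMagnonRookHopping
import Summits.HubbardSuperconductivity.HubbardSuperconductivity.Theorems.AnisotropyChordTwoMagnonCoordinates

/-!
# Route `AnisotropyChord`: the `3 × 3` class reduction of the two-magnon block on the rook graph and
# its exact one-parameter solution (toolkit, part 3, for the two-magnon rung TM-VT on `K_m □ K_n`)

For a two-magnon eigenvector `χ` of `H(Δ) = xxzHamiltonian 1 G (−1) Δ` on the rook graph
`G = K_{p+1} □ K_{q+1}` that is constant on the three pair classes (values `a`, `b`, `c` on row,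
column and far pairs), the eigen-equation in pair coordinates (`xxz_mulVec_pair` + the neighbour
sums of `…TwoMagnonRookHopping`) is the `3 × 3` system (`rook_eigen_relations`)
`E a = −Δ(Z+1) a − ((p−1) a + q c)`, `E b = −Δ(Z+1) b − ((q−1) b + p c)`,
`E c = −Δ Z c − (a + b + (p+q−2) c)`, `Z = |E(G)|/4 − k`.  Its positive solutions are an explicit
ONE-parameter family (`rook_t_param`, elementary algebra): with `t := −E − Δ(Z+1) − (p+q−1)`,
`(q+t) a = q c`, `(p+t) b = p c`, and `1 − Δ = t·(1 + 1/(p+t) + 1/(q+t))`; for `Δ ≤ 1` necessarily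
`t ≥ 0`.  (So the anisotropy `σ = 1 − Δ` and the "detuning" `t` determine each other monotonically,
`…TwoMagnonRookOverlap`.)  Also the real form of the pair-class double sum
(`sum_pairs_of_classes_real`).  Theory seat `hubbard-h0-rotor-theory-1`, cycle 5 (rook family,
equitable `3`-class quotient).  No definition is introduced.
-/

set_option linter.dupNamespace false

noncomputable section

namespace Summit.HubbardSuperconductivity.HubbardSuperconductivity.Theorems.AnisotropyChord.TwoMagnon

open Matrix Complex Finset
open Literature.MathematicalPhysics.QuantumLattice

variable {α β : Type*} [Fintype α] [DecidableEq α] [Fintype β] [DecidableEq β]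

/-- Real form of `sum_pairs_of_classes`. [folklore] -/
theorem sum_pairs_of_classes_real (h : α × β → α × β → ℝ) {a b c : ℝ}
    (ha : ∀ x y : α × β, x.1 ≠ y.1 → x.2 = y.2 → h x y = a)
    (hb : ∀ x y : α × β, x.1 = y.1 → x.2 ≠ y.2 → h x y = b)
    (hc : ∀ x y : α × β, x.1 ≠ y.1 → x.2 ≠ y.2 → h x y = c) :
    (∑ i : α × β, ∑ j : α × β, if i = j then 0 else h i j) =
      (Fintype.card α : ℝ) * (Fintype.card β : ℝ) *
        (((Fintype.card α : ℝ) - 1) * a + ((Fintype.card β : ℝ) - 1) * b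
          + ((Fintype.card α : ℝ) - 1) * ((Fintype.card β : ℝ) - 1) * c) := by
  have hC := sum_pairs_of_classes (fun i j => ((h i j : ℝ) : ℂ)) (a := (a : ℂ)) (b := (b : ℂ))
    (c := (c : ℂ)) (fun x y hx hy => by rw [ha x y hx hy]) (fun x y hx hy => by rw [hb x y hx hy])
    (fun x y hx hy => by rw [hc x y hx hy])
  apply Complex.ofReal_injective
  push_cast
  rw [← hC]
  refine Finset.sum_congr rfl fun i _ => Finset.sum_congr rfl fun j _ => ?_
  split_ifs <;> simp

section Eigen

variable {G : SimpleGraph (α × β)} [DecidableRel G.Adj]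

/-- **The `3 × 3` class reduction of the two-magnon eigen-equation on the rook graph.** For an
eigenvector `χ` of `H(Δ)` (`H χ = E χ`) taking the real values `a`, `b`, `c` on row, column and
far pairs, with `G` `k`-regular and `Z = |E(G)|/4 − k`, `p = |α| − 1`, `q = |β| − 1`:
`E a = −Δ(Z+1) a − ((p−1) a + q c)`, `E b = −Δ(Z+1) b − ((q−1) b + p c)`,
`E c = −Δ Z c − (a + b + ((p−1) + (q−1)) c)`. [folklore] -/
theorem rook_eigen_relations
    (hadj : ∀ x y : α × β, G.Adj x y ↔ (x.1 ≠ y.1 ∧ x.2 = y.2) ∨ (x.1 = y.1 ∧ x.2 ≠ y.2))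
    {k : ℕ} (hreg : G.IsRegularOfDegree k) {a₀ a₁ : α} (hα : a₀ ≠ a₁) {b₀ b₁ : β} (hβ : b₀ ≠ b₁)
    {χ : (α × β → Fin 2) → ℂ} {a b c : ℝ}
    (hA : ∀ x y : α × β, x.1 ≠ y.1 → x.2 = y.2 → χ (Pi.single x 1 + Pi.single y 1) = a)
    (hB : ∀ x y : α × β, x.1 = y.1 → x.2 ≠ y.2 → χ (Pi.single x 1 + Pi.single y 1) = b)
    (hC : ∀ x y : α × β, x.1 ≠ y.1 → x.2 ≠ y.2 → χ (Pi.single x 1 + Pi.single y 1) = c)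
    {Δ E : ℝ} (hH : xxzHamiltonian 1 G (-1) Δ *ᵥ χ = ((E : ℝ) : ℂ) • χ)
    (p q : ℝ) (hp : p = (Fintype.card α : ℝ) - 1) (hq : q = (Fintype.card β : ℝ) - 1) :
    E * a = -(Δ * (((G.edgeFinset.card : ℝ) / 4 - k) + 1)) * a - ((p - 1) * a + q * c) ∧
    E * b = -(Δ * (((G.edgeFinset.card : ℝ) / 4 - k) + 1)) * b - ((q - 1) * b + p * c) ∧
    E * c = -(Δ * ((G.edgeFinset.card : ℝ) / 4 - k)) * c - (a + b + ((p - 1) + (q - 1)) * c) := by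
  have hdeg : ∀ v : α × β, (G.degree v : ℝ) = k := fun v => by rw [hreg v]
  -- the three reference pairs
  have hrow : ((a₀, b₀) : α × β) ≠ (a₁, b₀) := fun h => hα (congrArg Prod.fst h)
  have hcol : ((a₀, b₀) : α × β) ≠ (a₀, b₁) := fun h => hβ (congrArg Prod.snd h)
  have hfar : ((a₀, b₀) : α × β) ≠ (a₁, b₁) := fun h => hα (congrArg Prod.fst h)
  have adjrow : G.Adj (a₀, b₀) (a₁, b₀) := (hadj _ _).2 (Or.inl ⟨hα, rfl⟩)
  have adjcol : G.Adj (a₀, b₀) (a₀, b₁) := (hadj _ _).2 (Or.inr ⟨rfl, hβ⟩)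
  have adjfar : ¬ G.Adj (a₀, b₀) (a₁, b₁) := by
    rw [hadj]; push Not; exact ⟨fun _ h => absurd h.symm hβ.symm, fun h => absurd h hα⟩
  -- evaluate the eigen-equation at a pair
  have heval : ∀ {i j : α × β}, i ≠ j →
      ((E : ℂ)) * χ (Pi.single i 1 + Pi.single j 1) =
        -((Δ * ((G.edgeFinset.card : ℝ) / 4 - ((G.degree i : ℝ) + (G.degree j : ℝ)) / 2
            + (if G.Adj i j then 1 else 0)) : ℝ) : ℂ) * χ (Pi.single i 1 + Pi.single j 1)
          - (1 / 4 : ℂ) * (2 * ((∑ y, if y = i ∨ y = j then 0 else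
                if G.Adj i y then χ (Pi.single y 1 + Pi.single j 1) else 0)
              + (∑ y, if y = i ∨ y = j then 0 else
                if G.Adj j y then χ (Pi.single i 1 + Pi.single y 1) else 0))) := by
    intro i j hij
    have h := congrFun hH (Pi.single i 1 + Pi.single j 1)
    rw [Pi.smul_apply, smul_eq_mul, xxz_mulVec_pair G Δ χ hij, hopSum_eq_two_mul G χ hij] at h
    exact h.symm
  refine ⟨?_, ?_, ?_⟩
  · have h := heval hrow
    rw [rowPair_hopSum hadj hA hC (i := (a₀, b₀)) (j := (a₁, b₀)) hα rfl,
      rowPair_hopSum' hadj hA hC (i := (a₀, b₀)) (j := (a₁, b₀)) hα rfl, if_pos adjrow,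
      hA (a₀, b₀) (a₁, b₀) hα rfl, hdeg, hdeg] at h
    apply Complex.ofReal_injective
    rw [hp, hq]
    push_cast at h ⊢
    linear_combination h
  · have h := heval hcol
    rw [colPair_hopSum hadj hB hC (i := (a₀, b₀)) (j := (a₀, b₁)) rfl hβ,
      colPair_hopSum' hadj hB hC (i := (a₀, b₀)) (j := (a₀, b₁)) rfl hβ, if_pos adjcol,
      hB (a₀, b₀) (a₀, b₁) rfl hβ, hdeg, hdeg] at h
    apply Complex.ofReal_injective
    rw [hp, hq]
    push_cast at h ⊢
    linear_combination h
  · have h := heval hfar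
    rw [farPair_hopSum hadj hA hB hC (i := (a₀, b₀)) (j := (a₁, b₁)) hα hβ,
      farPair_hopSum' hadj hA hB hC (i := (a₀, b₀)) (j := (a₁, b₁)) hα hβ, if_neg adjfar,
      add_zero, hC (a₀, b₀) (a₁, b₁) hα hβ, hdeg, hdeg] at h
    apply Complex.ofReal_injective
    rw [hp, hq]
    push_cast at h ⊢
    linear_combination h

end Eigen

/-- **The exact one-parameter solution of the rook `3 × 3` system** (elementary algebra): for
`p, q > 0`, `a, b ≥ 0`, `c > 0`, `Δ ≤ 1` and the three relations of `rook_eigen_relations`, the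
number `t := −E − Δ(Z+1) − (p+q−1)` satisfies `t ≥ 0`, `(q+t) a = q c`, `(p+t) b = p c` and
`1 − Δ = t (1 + 1/(p+t) + 1/(q+t))`. [folklore] -/
theorem rook_t_param {p q a b c Δ E Z : ℝ} (hp : 0 < p) (hq : 0 < q) (ha : 0 ≤ a) (hb : 0 ≤ b)
    (hc : 0 < c) (hΔ : Δ ≤ 1)
    (h1 : E * a = -(Δ * (Z + 1)) * a - ((p - 1) * a + q * c))
    (h2 : E * b = -(Δ * (Z + 1)) * b - ((q - 1) * b + p * c))
    (h3 : E * c = -(Δ * Z) * c - (a + b + ((p - 1) + (q - 1)) * c)) :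
    ∃ t : ℝ, 0 ≤ t ∧ (q + t) * a = q * c ∧ (p + t) * b = p * c ∧
      1 - Δ = t * (1 + 1 / (p + t) + 1 / (q + t)) := by
  set t : ℝ := -E - Δ * (Z + 1) - (p + q - 1) with ht
  have e1 : (q + t) * a = q * c := by rw [ht]; linear_combination -h1
  have e2 : (p + t) * b = p * c := by rw [ht]; linear_combination -h2
  have e3 : a + b = (t + 1 + Δ) * c := by rw [ht]; linear_combination h3
  have hqc : 0 < q * c := mul_pos hq hc
  have hpc : 0 < p * c := mul_pos hp hc
  have hapos : 0 < a := by
    rcases ha.lt_or_eq with h | h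
    · exact h
    · rw [← h, mul_zero] at e1; linarith
  have hbpos : 0 < b := by
    rcases hb.lt_or_eq with h | h
    · exact h
    · rw [← h, mul_zero] at e2; linarith
  have hqt : 0 < q + t := by
    by_contra hle
    have : (q + t) * a ≤ 0 := mul_nonpos_of_nonpos_of_nonneg (not_lt.mp hle) ha
    linarith
  have hpt : 0 < p + t := by
    by_contra hle
    have : (p + t) * b ≤ 0 := mul_nonpos_of_nonpos_of_nonneg (not_lt.mp hle) hb
    linarith
  have hσ : 1 - Δ = t * (1 + 1 / (p + t) + 1 / (q + t)) := by
    have hac : a = q * c / (q + t) := by rw [eq_div_iff hqt.ne']; linear_combination e1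
    have hbc : b = p * c / (p + t) := by rw [eq_div_iff hpt.ne']; linear_combination e2
    rw [hac, hbc] at e3
    field_simp at e3
    field_simp
    nlinarith [e3, hc]
  refine ⟨t, ?_, e1, e2, hσ⟩
  by_contra hneg
  have htneg : t < 0 := not_le.mp hneg
  have h1' : t / (p + t) < 0 := div_neg_of_neg_of_pos htneg hpt
  have h2' : t / (q + t) < 0 := div_neg_of_neg_of_pos htneg hqt
  have : t * (1 + 1 / (p + t) + 1 / (q + t)) = t + t / (p + t) + t / (q + t) := by ring
  rw [this] at hσ
  linarith

end Summit.HubbardSuperconductivity.HubbardSuperconductivity.Theorems.AnisotropyChord.TwoMagnon
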